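import Literature.Probability.LatticeModels.ScaleFrameKernelPaths
import Literature.Probability.LatticeModels.ScaleFrameQuasiMultGlue
import Literature.Probability.LatticeModels.RandomClusterArmConditioningOff
import Literature.Probability.LatticeModels.RandomClusterConditionalDomination
import Literature.Probability.LatticeModels.RandomClusterRegionToAnnulus
import Literature.Probability.LatticeModels.RandomClusterBoundaryPushingTools
import HarnessLib

/-!
# Kesten's kernel on a scale frame: the junk bound at the gap exploration (proved)

Topic `Literature/Probability/LatticeModels` (trunk `StatMech`, family `crit-ising`). The "junk"
estimate in the cross-ratio bound of the chain kernel of Kesten's ratio-limit scheme (H. Kesten,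
PTRF 73 (1986), §2, Lemma (23); D. Basu, A. Sapozhnikov, ECP 22 (2017), §2, eq. (2.9)) on an abstract
`ScaleFrame`: the gap annulus `(b, b')` is explored from OUTSIDE (`BlockExploration*.lean`, inner set
`outSet b b'`, block `annSet b b'`), and the configurations whose rim is NOT wired off the outside
carry no open separator of `(b, b')` (`ScaleFrame.explRimWiredOff_of_sepEvent_out`); the separator is
an increasing event of the frame edges touching the annulus whose conditional probability, given
any configuration of the other edges, is at least the constant `c` of the free local bound
`SepBound` (comparison of boundary conditions for the decreasing complement,
`rcMeasure_real_inter_cylinder_le_mul_fromEdgeSet_of_isLowerSet`, the wired vertices of the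
environment being isolated from the annulus edges), so that by the relative successive-conditioning
bound `rcMeasure_real_inter_inter_biInter_compl_le` (one region): for every increasing `A` and every
context event `Fo` read off the annulus edges,
`μ(A ∩ Fo ∩ {rim not wired off}) ≤ (1 - c) μ(A ∩ Fo)` under any environment measure `μ` of frame
edges containing the annulus edges (`ScaleFrame.rcMeasure_real_inter_notWiredOff_le`).
Everything is proved; no definitions, no named facts.

## References

* [Kesten1986] H. Kesten, *Probab. Theory Related Fields* 73 (1986) 369–394, §2, Lemma (23) and
  the estimate (8) in the proof of Thm. 3.
* [BasuSapozhnikov2017ECP] D. Basu, A. Sapozhnikov, *Electron. Commun. Probab.* 22 (2017) no. 26,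
  §2, eq. (2.9).
* G. Grimmett, *The Random-Cluster Model*, Springer (2006): Thm. (3.8)(b), Lemma (4.13), (4.14).
-/

noncomputable section

open MeasureTheory Finset SimpleGraph
open Literature.Probability.Percolation (BondConfig openConnIn explSet explRim)

namespace Literature.Probability.LatticeModels

namespace ScaleFrame

variable {V : Type*} [Fintype V] [DecidableEq V] (F : ScaleFrame V)

/-- **The conditional separator bound.** Under an environment measure `μ = φ^{Benv}_{⟨Eenv⟩}` whose
graph contains the genuine frame edges `U₁` touching the annulus `(b, b')` and whose wired vertices
meet no such edge, the free local bound `SepBound p q c b b'` gives, for every configuration `ξ` of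
the other edges, `c · μ({ω ∖ U₁ = ξ}) ≤ μ({ω ∩ U₁ separates} ∩ {ω ∖ U₁ = ξ})`: the complement is
decreasing, so its conditional probability is at most its probability under `φ^{Benv}_{⟨U₁⟩}`, which
is the free local measure (isolated wired vertices). [cite: Kesten1986, §2 eq. (28) and proof of Thm. 3] -/
theorem sep_cylinder_bound {p q c b b' : ℝ} (hp : p ∈ Set.Icc (0 : ℝ) 1) (hq : 1 ≤ q)
    (hSB : F.SepBound p q c b b') (Eenv : Finset (Sym2 V))
    (hTE : ∀ e ∈ F.edgesTouching (F.annSet b b'), ¬ e.IsDiag → e ∈ Eenv) (Benv : Set V)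
    (hBenv : ∀ v ∈ Benv, ∀ e ∈ F.edgesTouching (F.annSet b b'), v ∉ e) (ξ : Set (Sym2 V)) :
    let U₁ : Finset (Sym2 V) := (F.edgesTouching (F.annSet b b')).filter fun e => ¬ e.IsDiag
    let μ := rcMeasure (fromEdgeSet (↑Eenv : Set (Sym2 V))) p q Benv
    c * μ.real {ω | ω ∩ (↑U₁ : Set (Sym2 V))ᶜ = ξ} ≤
      μ.real ({ω | ω ∩ (↑U₁ : Set (Sym2 V)) ∈ F.sepEvent b b'} ∩
        {ω | ω ∩ (↑U₁ : Set (Sym2 V))ᶜ = ξ}) := by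
  intro U₁ μ
  classical
  have hq0 : 0 < q := one_pos.trans_le hq
  haveI := isProbabilityMeasure_rcMeasure (fromEdgeSet (↑Eenv : Set (Sym2 V))) hp hq0 Benv
  haveI := isProbabilityMeasure_rcMeasure (fromEdgeSet (↑U₁ : Set (Sym2 V))) hp hq0 Benv
  have hU₁ : ∀ i, U₁ ⊆ @edgeFinset V (fromEdgeSet (↑Eenv : Set (Sym2 V))) i := fun i e he =>
    (mem_edgeFinset_fromEdgeSet_iff Eenv i e).2
      ⟨hTE e (Finset.mem_filter.1 he).1 (Finset.mem_filter.1 he).2, (Finset.mem_filter.1 he).2⟩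
  -- the decreasing complement, conditionally on the cylinder
  have h1 := rcMeasure_real_inter_cylinder_le_mul_fromEdgeSet_of_isLowerSet
    (fromEdgeSet (↑Eenv : Set (Sym2 V))) hp hq Benv U₁ (hU₁ _) ξ (F.isUpperSet_sepEvent b b').compl
  -- the local measure with `Benv` wired is the free local measure: `Benv` is isolated in `⟨U₁⟩`
  have h2 : c ≤ (rcMeasure (fromEdgeSet (↑U₁ : Set (Sym2 V))) p q Benv).real (F.sepEvent b b') := by
    have hiso : ∀ v ∈ (Set.toFinite Benv).toFinset, ∀ w : V,
        ¬ (fromEdgeSet (↑U₁ : Set (Sym2 V))).Adj v w := by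
      intro v hv w hvw
      rw [Set.Finite.mem_toFinset] at hv
      rw [fromEdgeSet_adj, Finset.mem_coe] at hvw
      exact hBenv v hv _ (Finset.mem_filter.1 hvw.1).1 (Sym2.mem_mk_left v w)
    have h3 := rcMeasure_real_union_isolated (fromEdgeSet (↑U₁ : Set (Sym2 V))) hp hq0 ∅
      (Set.toFinite Benv).toFinset hiso (F.sepEvent b b')
    rw [Set.Finite.coe_toFinset, Set.empty_union] at h3
    have hG : fromEdgeSet (↑U₁ : Set (Sym2 V)) =
        fromEdgeSet (↑(F.edgesTouching (F.annSet b b')) : Set (Sym2 V)) := by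
      ext u v
      simp only [fromEdgeSet_adj, Finset.coe_filter, Set.mem_setOf_eq, Sym2.mk_isDiag_iff,
        Finset.mem_coe, U₁]
      tauto
    rw [h3, rcMeasure_congr_graph hG p q ∅]
    exact hSB
  have h4 : (rcMeasure (fromEdgeSet (↑U₁ : Set (Sym2 V))) p q Benv).real (F.sepEvent b b')ᶜ ≤
      1 - c := by
    rw [probReal_compl_eq_one_sub MeasurableSet.of_discrete]
    linarith
  have h5 : μ.real ({ω | ω ∩ (↑U₁ : Set (Sym2 V)) ∈ F.sepEvent b b'}ᶜ ∩
        {ω | ω ∩ (↑U₁ : Set (Sym2 V))ᶜ = ξ}) ≤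
      (1 - c) * μ.real {ω | ω ∩ (↑U₁ : Set (Sym2 V))ᶜ = ξ} :=
    calc μ.real ({ω | ω ∩ (↑U₁ : Set (Sym2 V)) ∈ F.sepEvent b b'}ᶜ ∩
          {ω | ω ∩ (↑U₁ : Set (Sym2 V))ᶜ = ξ})
        = μ.real ({ω | ω ∩ (↑U₁ : Set (Sym2 V)) ∈ (F.sepEvent b b')ᶜ} ∩
            {ω | ω ∩ (↑U₁ : Set (Sym2 V))ᶜ = ξ}) := rfl
      _ ≤ μ.real {ω | ω ∩ (↑U₁ : Set (Sym2 V))ᶜ = ξ} *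
            (rcMeasure (fromEdgeSet (↑U₁ : Set (Sym2 V))) p q Benv).real (F.sepEvent b b')ᶜ := h1
      _ ≤ μ.real {ω | ω ∩ (↑U₁ : Set (Sym2 V))ᶜ = ξ} * (1 - c) :=
          mul_le_mul_of_nonneg_left h4 measureReal_nonneg
      _ = (1 - c) * μ.real {ω | ω ∩ (↑U₁ : Set (Sym2 V))ᶜ = ξ} := mul_comm _ _
  have h6 := measureReal_inter_add_sdiff (μ := μ) (s := {ω | ω ∩ (↑U₁ : Set (Sym2 V))ᶜ = ξ})
    (t := {ω | ω ∩ (↑U₁ : Set (Sym2 V)) ∈ F.sepEvent b b'}) MeasurableSet.of_discrete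
  rw [Set.sdiff_eq, Set.inter_comm {ω | ω ∩ (↑U₁ : Set (Sym2 V))ᶜ = ξ}
    ({ω | ω ∩ (↑U₁ : Set (Sym2 V)) ∈ F.sepEvent b b'}ᶜ),
    Set.inter_comm {ω | ω ∩ (↑U₁ : Set (Sym2 V))ᶜ = ξ}] at h6
  linarith

/-- **The junk bound of the kernel** (Kesten 1986, proof of Thm. 3, estimate (8); Basu–Sapozhnikov
2017, §2 eq. (2.9)). Let `μ = φ^{Benv}_{⟨Eenv⟩}` be an environment measure of frame edges containing the
genuine edges touching the annulus `(b, b')`, with wired vertices off those edges, let the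
configuration be read on a set of frame pairs `Rd` containing those edges, let `A` be increasing and
`Fo` read off the edges touching the annulus. Then the configurations of `A ∩ Fo` whose rim (of the
exploration of `annSet b b'` from `outSet b b'`, read on `Rd`) is NOT wired off the outside have mass
at most `(1 - c) μ(A ∩ Fo)`: they carry no open separator of `(b, b')` among the annulus edges, and
the separator has conditional probability `≥ c` given everything else.
[cite: Kesten1986, §2 Lemma (23)] -/
theorem rcMeasure_real_inter_notWiredOff_le {p q c b b' : ℝ} (hp : p ∈ Set.Ico (0 : ℝ) 1)
    (hq : 1 ≤ q) (hc1 : c ≤ 1) (hSB : F.SepBound p q c b b') (Eenv : Finset (Sym2 V))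
    (hTE : ∀ e ∈ F.edgesTouching (F.annSet b b'), ¬ e.IsDiag → e ∈ Eenv) (Benv : Set V)
    (hBenv : ∀ v ∈ Benv, ∀ e ∈ F.edgesTouching (F.annSet b b'), v ∉ e)
    (Rd : Set (Sym2 V)) (hRdE : Rd ⊆ (↑F.E : Set (Sym2 V)))
    (hTRd : ∀ e ∈ F.edgesTouching (F.annSet b b'), ¬ e.IsDiag → e ∈ Rd)
    {A : Set (BondConfig V)} (hA : IsUpperSet A) {Fo : Set (BondConfig V)}
    (hFo : ∀ ω₁ ω₂ : BondConfig V,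
      (∀ e, e ∉ F.edgesTouching (F.annSet b b') → (e ∈ ω₁ ↔ e ∈ ω₂)) → (ω₁ ∈ Fo ↔ ω₂ ∈ Fo)) :
    let Rest : Set V := F.outSet b b'
    let Blk : Set V := F.annSet b b'
    let μ := rcMeasure (fromEdgeSet (↑Eenv : Set (Sym2 V))) p q Benv
    μ.real (A ∩ Fo ∩ {ω | ¬ (∀ r ∈ explRim Rest Blk (ω ∩ Rd), ∀ r₂ ∈ explRim Rest Blk (ω ∩ Rd),
        ∃ v ∈ explSet Rest Blk (ω ∩ Rd) \ Rest, ∃ v' ∈ explSet Rest Blk (ω ∩ Rd) \ Rest,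
          s(v, r) ∈ ω ∩ Rd ∧ s(v', r₂) ∈ ω ∩ Rd ∧
            ω ∩ Rd ∈ openConnIn (explSet Rest Blk (ω ∩ Rd) \ Rest) v v')}) ≤
      (1 - c) * μ.real (A ∩ Fo) := by
  intro Rest Blk μ
  classical
  have hp' : p ∈ Set.Icc (0 : ℝ) 1 := ⟨hp.1, hp.2.le⟩
  have hq0 : 0 < q := one_pos.trans_le hq
  haveI := isProbabilityMeasure_rcMeasure (fromEdgeSet (↑Eenv : Set (Sym2 V))) hp' hq0 Benv
  set U₁ : Finset (Sym2 V) := (F.edgesTouching (F.annSet b b')).filter fun e => ¬ e.IsDiag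
    with hU₁_def
  set S₁ : Set (BondConfig V) := {ω | ω ∩ (↑U₁ : Set (Sym2 V)) ∈ F.sepEvent b b'} with hS₁_def
  have hU₁Rd : (↑U₁ : Set (Sym2 V)) ⊆ Rd := fun e he =>
    hTRd e (Finset.mem_filter.1 (Finset.mem_coe.1 he)).1 (Finset.mem_filter.1 (Finset.mem_coe.1 he)).2
  -- (i) no off-wiring of the rim means no open separator among the annulus edges
  have hincl : A ∩ Fo ∩ {ω | ¬ (∀ r ∈ explRim Rest Blk (ω ∩ Rd), ∀ r₂ ∈ explRim Rest Blk (ω ∩ Rd),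
        ∃ v ∈ explSet Rest Blk (ω ∩ Rd) \ Rest, ∃ v' ∈ explSet Rest Blk (ω ∩ Rd) \ Rest,
          s(v, r) ∈ ω ∩ Rd ∧ s(v', r₂) ∈ ω ∩ Rd ∧
            ω ∩ Rd ∈ openConnIn (explSet Rest Blk (ω ∩ Rd) \ Rest) v v')} ⊆
      A ∩ Fo ∩ ⋂ i ∈ (Finset.univ : Finset Unit), S₁ᶜ := by
    rintro ω ⟨hAF, hNW⟩
    refine ⟨hAF, Set.mem_iInter₂.2 fun _ _ hS => hNW ?_⟩
    have hsep : ω ∩ Rd ∈ F.sepEvent b b' :=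
      F.isUpperSet_sepEvent b b' (Set.inter_subset_inter_right ω hU₁Rd) hS
    exact F.explRimWiredOff_of_sepEvent_out (Set.inter_subset_right.trans hRdE) hsep
  -- (ii) one region: the relative successive-conditioning bound
  have key := rcMeasure_real_inter_inter_biInter_compl_le (fromEdgeSet (↑Eenv : Set (Sym2 V))) hp'
    hq Benv (Finset.univ : Finset Unit) (fun _ => U₁) (fun _ _ _ _ h => (h rfl).elim)
    (fun _ => S₁) (fun _ _ => fun ω₁ ω₂ hle hω₁ => F.isUpperSet_sepEvent b b'
      (Set.inter_subset_inter_left _ hle) hω₁)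
    (fun _ _ ω₁ ω₂ h => by simp only [hS₁_def, Set.mem_setOf_eq, h]) (fun _ => c)
    (fun _ _ => hc1) (fun _ _ ξ _ => F.sep_cylinder_bound hp' hq hSB Eenv hTE Benv hBenv ↑ξ) hA
    (F := Fo) fun _ _ ω₁ ω₂ h => hFo ω₁ ω₂ fun e he => by
      have heU : e ∈ (↑U₁ : Set (Sym2 V))ᶜ := fun heU =>
        he (Finset.mem_filter.1 (Finset.mem_coe.1 heU)).1
      constructor
      · intro h1
        have : e ∈ ω₂ ∩ (↑U₁ : Set (Sym2 V))ᶜ := h ▸ ⟨h1, heU⟩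
        exact this.1
      · intro h2
        have : e ∈ ω₁ ∩ (↑U₁ : Set (Sym2 V))ᶜ := h.symm ▸ ⟨h2, heU⟩
        exact this.1
  rw [Finset.prod_const, Finset.card_univ, Fintype.card_unit, pow_one] at key
  exact (measureReal_mono hincl (measure_ne_top _ _)).trans key

end ScaleFrame

end Literature.Probability.LatticeModels

end
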